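import Summits.AtomisticToContinuum.HydrodynamicLimit.Theorems.JParityClosureLocalSecondLawLedgerDefs

/-!
# Equilibrium stub `eq_detIdentity`: the deterministic space–time identity

Registered stub of the equilibrium side-composition of line `exact-entropy-ledger-three-passivities` for the crux
`JParityClosure.LocalSecondLaw` (stmt-AtomisticToContinuum-13081, lead c2).  Pure calculus, no probability: for a
jointly smooth test function `φ` on `ℝ × 𝕋³` vanishing from some time `τ' < τ` on, and constants `c`, `ū`,

  `∫_{s ∈ [0,τ]} ∫_{𝕋³} c (∂ₛφ(s,x) + ∑ₖ ūₖ ∂ₖφ(s,x)) dx ds = −c ∫_{𝕋³} φ(0,x) dx`.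

Proof: for each `s` the transport term has zero space mean (`∫_{𝕋³} ∂ₖ(φ s) = 0`, no boundary on the torus,
`Torus.integral_partialDeriv_eq_zero_holds`), and `s ↦ ∫ φ(s,x) dx` has derivative `∫ ∂ₛφ(s,x) dx`
(differentiation under the integral sign, `Torus.IsSmoothSpaceTimeOn.hasDerivWithinAt_integral`); the fundamental
theorem of calculus on `[0, τ]` and `φ(τ, ·) = 0` finish.  This is step (2) of the lead's composition
(`Idet σ Θ ū τ φ` is the left-hand side with `c = Hs σ 1 Θ`).

References: L. C. Evans, *Partial Differential Equations* (2nd ed., 2010), App. C.2 Thm. 1 (Gauss–Green; empty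
boundary on the torus).
-/

noncomputable section

namespace Summit.AtomisticToContinuum.HydrodynamicLimit.Theorems.LocalSecondLawEquilibrium

open scoped BigOperators Topology Classical MeasureTheory ENNReal InnerProductSpace
open Filter Set MeasureTheory
open Literature.MathematicalPhysics.KineticTheory
open Literature.Analysis.FluidPDE
open Literature.Analysis.FunctionSpaces
open Summit.AtomisticToContinuum.HydrodynamicLimit.Theorems.LocalSecondLawNegative
open Summit.AtomisticToContinuum.HydrodynamicLimit.Theorems.LocalSecondLawLedger

/-- **Space mean of the deterministic integrand.** For a jointly smooth `φ` and every time `s`,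
`∫_{𝕋³} c (∂ₛφ(s,x) + ∑ₖ ūₖ ∂ₖφ(s,x)) dx = c ∫_{𝕋³} ∂ₛφ(s,x) dx`: the transport term has zero mean on the torus.
[folklore] -/
theorem integral_detIntegrand_eq (c : ℝ) (ū : V3) {φ : ℝ → T3 → ℝ}
    (hφ : Torus.IsSmoothSpaceTimeOn Set.univ φ) (s : ℝ) :
    ∫ x : T3, c * (deriv (fun s' => φ s' x) s + ∑ k : Fin 3, ū k * pD k (φ s) x)
      = c * ∫ x : T3, Torus.timeDerivWithin Set.univ φ s x := by
  have hsl : Torus.IsSmooth (φ s) := hφ.isSmooth_slice (Set.mem_univ s)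
  have htd : Torus.IsSmooth (Torus.timeDerivWithin Set.univ φ s) :=
    hφ.isSmooth_timeDerivWithin uniqueDiffOn_univ (Set.mem_univ s)
  have hAeq : (fun x : T3 => deriv (fun s' => φ s' x) s) = Torus.timeDerivWithin Set.univ φ s := by
    funext x
    simp [Torus.timeDerivWithin, derivWithin_univ]
  have hA : Integrable (fun x : T3 => deriv (fun s' => φ s' x) s) := by
    rw [hAeq]
    exact htd.integrable
  have hB : ∀ k : Fin 3, Integrable (fun x : T3 => ū k * pD k (φ s) x) := fun k =>
    (hsl.partialDeriv k).integrable.const_mul (ū k)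
  have hBs : Integrable (fun x : T3 => ∑ k : Fin 3, ū k * pD k (φ s) x) :=
    integrable_finsetSum _ fun k _ => hB k
  rw [integral_const_mul]
  congr 1
  rw [integral_add hA hBs, integral_finsetSum _ fun k _ => hB k]
  have h0 : ∀ k : Fin 3, ∫ x : T3, ū k * pD k (φ s) x = 0 := fun k => by
    rw [integral_const_mul]
    have h := Torus.integral_partialDeriv_eq_zero_holds hsl k
    simp only [pD, h, mul_zero]
  simp only [h0, Finset.sum_const_zero, add_zero]
  refine integral_congr_ae (Eventually.of_forall fun x => ?_)
  simp [Torus.timeDerivWithin, derivWithin_univ]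

/-- **Registered stub `eq_detIdentity`** (line `exact-entropy-ledger-three-passivities`, equilibrium side
composition): for a jointly smooth test function vanishing from some `τ' < τ` on,
`∫₀^τ ∫_{𝕋³} c (∂ₛφ + ū·∇φ) = −c ∫_{𝕋³} φ(0,·)` (zero mean of `∂ₖφ` on the torus, differentiation under the
integral sign, fundamental theorem of calculus). [folklore] -/
theorem eq_detIdentity :
  ∀ (c τ : ℝ) (ū : V3) (φ : ℝ → T3 → ℝ), 0 < τ →
    Literature.Analysis.FunctionSpaces.Torus.IsSmoothSpaceTimeOn Set.univ φ →
    (∃ τ' : ℝ, τ' < τ ∧ ∀ s, τ' ≤ s → ∀ x, φ s x = 0) →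
    ∫ s in Set.Icc (0 : ℝ) τ, ∫ x : T3, c * (deriv (fun s' => φ s' x) s + ∑ k : Fin 3, ū k * pD k (φ s) x)
      = -(c * ∫ x : T3, φ 0 x) := by
  intro c τ ū φ hτ hφ hvan
  obtain ⟨τ', hτ'τ, hzero⟩ := hvan
  have hderiv : ∀ s, HasDerivAt (fun s => ∫ x : T3, φ s x)
      (∫ x : T3, Torus.timeDerivWithin Set.univ φ s x) s := fun s =>
    (hφ.hasDerivWithinAt_integral convex_univ (Set.mem_univ s)).hasDerivAt Filter.univ_mem
  have hcont : Continuous fun s => ∫ x : T3, Torus.timeDerivWithin Set.univ φ s x := by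
    have h := (hφ.timeDerivWithin uniqueDiffOn_univ).continuousOn_integral convex_univ
    exact continuousOn_univ.1 h
  have hinner : ∀ s, ∫ x : T3, c * (deriv (fun s' => φ s' x) s + ∑ k : Fin 3, ū k * pD k (φ s) x)
      = c * ∫ x : T3, Torus.timeDerivWithin Set.univ φ s x := fun s => integral_detIntegrand_eq c ū hφ s
  have hτ0 : ∫ x : T3, φ τ x = 0 := by
    simp [hzero τ hτ'τ.le]
  simp_rw [hinner]
  rw [integral_const_mul, integral_Icc_eq_integral_Ioc, ← intervalIntegral.integral_of_le hτ.le,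
    intervalIntegral.integral_eq_sub_of_hasDerivAt (fun s _ => hderiv s) (hcont.intervalIntegrable _ _),
    hτ0, zero_sub, mul_neg]

end Summit.AtomisticToContinuum.HydrodynamicLimit.Theorems.LocalSecondLawEquilibrium

end
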